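import Summits.ABC.IUTFork.Thm311RealInd1StripDepthEFixed
import Summits.ABC.IUTFork.Thm311RealInd1StripPacketFloor
import HarnessLib

/-!
# [IUTchIII] Thm 3.11 (i) (Ind1)+(Ind2) on a TENSOR PACKET of genuine completions: the BOX DEFECT of a failing depth-`e` bit — if at a factor `b`
# of residue degree one NO realised strip automorphism moves the base line modulo `𝔪^{e_b+1}`, the orbit of the BOX under any factorwise-strip
# group has every component radius below the container's by the factor `p^{−(e_b−1)/e_b}` (UNCONDITIONAL)

PROOF-ONLY file (abc-iut cell, Cor. 3.12 sub-crew, seat abc-iut-c312-1 = holder of record of the typed [IUTchIII] Thm. 3.11, gen 18; row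
«R24 = C:F1-DEPTH-E-DICHOTOMY», KEY F1DICHOTOMY, C LEAD ruling C-R152 (f); file 6 of the row — the packet form of file 1's branch (ii), the
«failure quantified»).  TAKES NO SIDE on [IUTchIII] Cor. 3.12.  No definition, no `Prop` fact, NO `JannsenWingbergMappingClass`.

SETTING.  Genuine packet `X = ⊗_{ℚ_p, i} K_{w_i}`, every factor tame; a factor `b` of residue degree `f(w_b|p) = 1` at which NO realised strip
automorphism moves the base line `ℤ_p·p` modulo `p·log_p(𝒪_{w_b}^×)` (the NEGATION of the displayed bit of files 1–5); the BOX
`B = {⊗_i x_i : ‖x_b‖ ≤ ‖c_b‖·p⁻¹, x_i ∈ c_i·log_p(𝒪_{w_i}^×) (i ≠ b)}` — at a genuine place-section packet the pure tensors of `ι_j(t)·R_I` are of this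
shape with `c_b = p⁻¹` off the twisted slot (`𝒪_b = p⁻¹·𝔪^{e_b}`).  A subgroup `H` of `Aut_{ℚ_p}(X)` ACTS FACTORWISE THROUGH THE REALISED STRIP GROUPS
if every `γ ∈ H` maps pure tensors as `⊗ z ↦ ⊗ δ_i(z_i)` with `δ_i` in the group generated by `Real.ind1StripOf w_i (galoisLog w_i)` — e.g. the group
GENERATED by the single-factor strip moves of the junction files (`factorwise_of_mem_closure_singleFactor`).

* §1 (one place) `of_apply_mem_smul_logUnits_of_mem_closure` — every element of the strip GROUP (and its inverse) maps `c·log_p(𝒪_v^×)` into itself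
  (R9 L-stability + `ℚ_p`-linearity, p516833 §1, through `AddSubgroup.closure`).
* §2 `factorwise_of_mem_closure_singleFactor` — the subgroup generated by single-factor strip moves acts factorwise through the strip groups.
* §3 **`norm_dEquiv_apply_le_of_factorwise_of_fixesBaseLine`** — for every `γ` of a factorwise-strip `H` and every pure tensor of the box:
  `‖ψ(γ(⊗x))_j‖ ≤ (‖c_b‖·p⁻¹)·Π_{i≠b} ‖c_i‖·p^{−1/e_i}` in EVERY Wedderburn component `j` (file 1: the whole strip group at `w_b` carries the depth-`e_b`
  ball onto itself; §1 at the other factors; `‖ψ(⊗y)_j‖ = Π_i ‖y_i‖`); hence **`packetHull_orbit_box_subset_polydisc_of_fixesBaseLine`**: the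
  `(R_I)^∼`-hull of the `H`-orbit of the box lies in the polydisc of that radius, which is the container radius `Π_i ‖c_i‖·p^{−1/e_i}` times
  `p^{−(e_b−1)/e_b} < 1` (`e_b ≥ 2`), a radius the container span `(Π_i c_i)·log_p(R_I^×)` attains — so the two hulls DIFFER: a log-volume defect of
  `(e_b − 1)/e_b·log p` per unit weight at that factor, for the BOX.
READING (numbers about OUR typed objects; neutral): this is the packet shadow of file 1 for the BOX `ι_j(t)·R_I` only.  The Θ-region of [IUTchIII]
Cor. 3.12 is `ι_j(t)·(R_I)^∼ ⊇ ι_j(t)·R_I`; when `(R_I)^∼ ⊋ R_I` (two ramified factors) the normalisation contains idempotent-type elements whose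
factor-`b` parts have depth `< e_b` and are inflated WITHOUT the bit (p530814), so the exact packet-level condition for the junction identity under a
failing bit is FINER than the per-factor bits and is NOT computed here (nor anywhere in the row).  HONEST SCOPE: unconditional; OUR typing of
print's (Ind1) (THE equivariant lift, THE logarithm; factorwise action as in p516014; F-B28-1 untouched); nothing here computes a log-volume; no
side taken on [IUTchIII] Cor. 3.12 / [IUTchIV] Thm. 1.10 or on any author; NO abc claim. [claim: Mochizuki2012, status: disputed];
[cite: Mochizuki2012, IUTchIII Thm. 3.11 (i) p. 154; Rmk. 3.9.5 (i) p. 127; Cor. 3.12 Step (xi) p. 183; IUTchIV Prop. 1.2 (ii) pp. 10–11, Prop. 1.4 (i) p. 13];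
[cite: DupuyHilado2025, §4.9, §4.12]. typed ≠ proved; equal-AS-TYPED ≠ equal in print.
-/

set_option autoImplicit false

noncomputable section

open Metric Set Bornology Function
open scoped Pointwise TensorProduct

namespace Summit.ABC.IUTFork.Thm311.Real

open NumberField IsDedekindDomain Literature.NumberTheory.NumberFields Literature.IUT.LogVolume
open Literature.NumberTheory.GaloisRepresentations Literature.NumberTheory.GaloisRepresentations.Ultrametric
open Literature.AnabelianGeometry.AbsoluteAnabelian Literature.IUT.HodgeArakelov
open Literature.IUT.HodgeArakelov.AbsTopMonoids

/-! ## §1 One place: the strip GROUP maps `c·log_p(𝒪_v^×)` into itself -/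

section OnePlace

variable {F : Type} [Field F] [NumberField F] (v : HeightOneSpectrum (𝓞 F))

/-- **Every element of the group generated by print's (Ind1) strip part maps `c·log_p(𝒪_v^×)` into itself** (and so does its inverse):
generators by R9's L-stability + `ℚ_p`-linearity (p516833 §1 `sub_mem_smul_logUnits_inter_ker_trace_of_mem_ind1StripOf`,
`symm_mem_smul_logUnits_of_mem_ind1StripOf`), then induction through `AddSubgroup.closure` (Mathlib writes `AddAut K_v` additively).
[claim: Mochizuki2012, status: disputed] [cite: Mochizuki2012, IUTchIII Thm. 3.11 (i) p. 154] -/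
theorem of_apply_mem_smul_logUnits_of_mem_closure (p : ℕ) [Fact p.Prime] (hv : ((p : ℕ) : 𝓞 F) ∈ v.asIdeal)
    {γ : AddAut (v.adicCompletion F)}
    (hγ : γ ∈ AddSubgroup.closure (G := AddAut (v.adicCompletion F)) (ind1StripOf v (galoisLog v))) (c : ℚ_[p])
    {x : v.adicCompletion F} (hx : RescaledCompletion.of F p v hv x ∈ c • logUnits (RescaledCompletion F p v hv)) :
    RescaledCompletion.of F p v hv (γ x) ∈ c • logUnits (RescaledCompletion F p v hv) ∧
      RescaledCompletion.of F p v hv (γ.symm x) ∈ c • logUnits (RescaledCompletion F p v hv) := by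
  set e := RescaledCompletion.of F p v hv with he_def
  set C : Set (RescaledCompletion F p v hv) := c • logUnits (RescaledCompletion F p v hv) with hC
  have hCadd : ∀ a b' : RescaledCompletion F p v hv, a ∈ C → b' ∈ C → a + b' ∈ C := by
    intro a b' ha hb
    obtain ⟨a', ha', rfl⟩ := Set.mem_smul_set.mp ha
    obtain ⟨b'', hb'', rfl⟩ := Set.mem_smul_set.mp hb
    rw [← smul_add]
    exact Set.smul_mem_smul_set ((logUnitsAddSubgroup p (RescaledCompletion F p v hv)).add_mem
      (show a' ∈ logUnitsAddSubgroup p _ from ha') (show b'' ∈ logUnitsAddSubgroup p _ from hb''))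
  revert x
  induction hγ using AddSubgroup.closure_induction with
  | mem ψ hψ =>
    intro x hx
    refine ⟨?_, symm_mem_smul_logUnits_of_mem_ind1StripOf v p hv hψ c hx⟩
    have h := (sub_mem_smul_logUnits_inter_ker_trace_of_mem_ind1StripOf v p hv hψ c hx).1
    have h' := hCadd _ _ h hx
    rwa [sub_add_cancel] at h'
  | zero => intro x hx; exact ⟨hx, hx⟩
  | add γ₁ γ₂ _ _ ih₁ ih₂ =>
    intro x hx
    refine ⟨?_, ?_⟩
    · rw [AddAut.add_apply]; exact (ih₁ (ih₂ hx).1).1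
    · have h : (γ₁ + γ₂).symm x = γ₂.symm (γ₁.symm x) := rfl
      rw [h]; exact (ih₂ (ih₁ hx).2).2
  | neg γ _ ih =>
    intro x hx
    refine ⟨?_, ?_⟩
    · rw [AddAut.neg_apply]; exact (ih hx).2
    · have h : (-γ).symm x = γ x := by rw [AddAut.neg_def, AddEquiv.symm_symm]
      rw [h]; exact (ih hx).1

end OnePlace

/-! ## §2 Packets: the group generated by single-factor strip moves acts factorwise through the strip groups -/

section Packet

variable {K : Type} [Field K] [NumberField K] (p : ℕ) [hp : Fact p.Prime]
variable {I : Type} [Fintype I] [DecidableEq I] (w : I → HeightOneSpectrum (𝓞 K)) (hw : ∀ i, ((p : ℕ) : 𝓞 K) ∈ (w i).asIdeal)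

omit [Fintype I] in
/-- **The subgroup generated by single-factor strip moves acts factorwise through the realised strip groups**: if every element of
`S ⊆ Aut_{ℚ_p}(X)` maps pure tensors by `⊗ z ↦ ⊗ z[i₀ ↦ ψ z_{i₀}]` for some factor `i₀` and some `ψ ∈ Real.ind1StripOf w_{i₀} (galoisLog w_{i₀})`,
then every `γ ∈ ⟨S⟩` maps `⊗ z ↦ ⊗_i δ_i(z_i)` with each `δ_i` in the group generated by `Real.ind1StripOf w_i (galoisLog w_i)` (products compose
the families, inverses invert them). [claim: Mochizuki2012, status: disputed] [cite: Mochizuki2012, IUTchIII Thm. 3.11 (i) p. 154] -/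
theorem factorwise_of_mem_closure_singleFactor
    (S : Set (PacketAlgebra p (fun i => RescaledCompletion K p (w i) (hw i)) ≃ₗ[ℚ_[p]]
      PacketAlgebra p (fun i => RescaledCompletion K p (w i) (hw i))))
    (hS : ∀ γ ∈ S, ∃ (i₀ : I) (ψ : (w i₀).adicCompletion K ≃+ (w i₀).adicCompletion K),
      ψ ∈ ind1StripOf (w i₀) (galoisLog (w i₀)) ∧
        ∀ z : Π i, RescaledCompletion K p (w i) (hw i),
          γ (PiTensorProduct.tprod ℚ_[p] z) =
            PiTensorProduct.tprod ℚ_[p] (update z i₀ (RescaledCompletion.of K p (w i₀) (hw i₀)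
              (ψ ((RescaledCompletion.of K p (w i₀) (hw i₀)).symm (z i₀))))))
    {γ : PacketAlgebra p (fun i => RescaledCompletion K p (w i) (hw i)) ≃ₗ[ℚ_[p]]
      PacketAlgebra p (fun i => RescaledCompletion K p (w i) (hw i))}
    (hγ : γ ∈ Subgroup.closure S) :
    ∃ δ : Π i, AddAut ((w i).adicCompletion K),
      (∀ i, δ i ∈ AddSubgroup.closure (G := AddAut ((w i).adicCompletion K)) (ind1StripOf (w i) (galoisLog (w i)))) ∧
      ∀ z : Π i, RescaledCompletion K p (w i) (hw i),
        γ (PiTensorProduct.tprod ℚ_[p] z) =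
          PiTensorProduct.tprod ℚ_[p] (fun i => RescaledCompletion.of K p (w i) (hw i)
            (δ i ((RescaledCompletion.of K p (w i) (hw i)).symm (z i)))) := by
  classical
  set e := fun i => RescaledCompletion.of K p (w i) (hw i) with he_def
  induction hγ using Subgroup.closure_induction with
  | mem γ hγS =>
    obtain ⟨i₀, ψ, hψ, hγ⟩ := hS γ hγS
    refine ⟨update (0 : Π i, AddAut ((w i).adicCompletion K)) i₀ ψ, fun i => ?_, fun z => ?_⟩
    · by_cases hi : i = i₀
      · subst hi; rw [update_self]; exact AddSubgroup.subset_closure hψ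
      · rw [update_of_ne hi]; exact AddSubgroup.zero_mem _
    · rw [hγ z]
      congr 1
      funext i
      by_cases hi : i = i₀
      · subst hi; rw [update_self, update_self]
      · rw [update_of_ne hi, update_of_ne hi, Pi.zero_apply, AddAut.zero_apply, (e i).apply_symm_apply]
  | one =>
    refine ⟨0, fun i => AddSubgroup.zero_mem _, fun z => ?_⟩
    rw [LinearEquiv.coe_one, id_eq]
    congr 1
  | mul γ₁ γ₂ _ _ ih₁ ih₂ =>
    obtain ⟨δ₁, hδ₁, h₁⟩ := ih₁
    obtain ⟨δ₂, hδ₂, h₂⟩ := ih₂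
    refine ⟨δ₁ + δ₂, fun i => AddSubgroup.add_mem _ (hδ₁ i) (hδ₂ i), fun z => ?_⟩
    rw [LinearEquiv.mul_apply, h₂, h₁]
    congr 1
  | inv γ _ ih =>
    obtain ⟨δ, hδ, h⟩ := ih
    refine ⟨-δ, fun i => AddSubgroup.neg_mem _ (hδ i), fun z => ?_⟩
    rw [LinearEquiv.coe_inv, LinearEquiv.symm_apply_eq, h]
    congr 1
    funext i
    rw [(e i).symm_apply_apply, Pi.neg_apply, AddAut.neg_apply, AddEquiv.apply_symm_apply, (e i).apply_symm_apply]

/-! ## §3 The box defect of a failing bit -/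

/-- **THE BOX IS CONFINED AT A FACTOR WITH A FAILING BIT (UNCONDITIONAL).**  On the genuine packet `X = ⊗_i K_{w_i}` with every factor tame
(`p > 2`, `e_i ≤ p − 2`), let `b` be a factor of residue degree `f(w_b|p) = 1` at which NO realised strip automorphism moves the base line
`ℤ_p·p` modulo `p·log_p(𝒪_{w_b}^×)`, and let `H ≤ Aut_{ℚ_p}(X)` act factorwise through the realised strip groups.  Then for every `γ ∈ H` and
every pure tensor `⊗_i x_i` of the BOX (`‖x_b‖ ≤ ‖c_b‖·p⁻¹`, `c_b ≠ 0`; `x_i ∈ c_i·log_p(𝒪_{w_i}^×)` for `i ≠ b`), in every Wedderburn component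
`j`: `‖ψ(γ(⊗x))_j‖ ≤ (‖c_b‖·p⁻¹)·Π_{i≠b} ‖c_i‖·p^{−1/e_i}` — the whole strip group at `w_b` carries the depth-`e_b` ball onto itself (file 1,
p550084), the strip groups elsewhere preserve `c_i·log_p` (§1), and `‖ψ(⊗y)_j‖ = Π_i ‖y_i‖`. [claim: Mochizuki2012, status: disputed]
[cite: Mochizuki2012, IUTchIII Thm. 3.11 (i) p. 154; IUTchIV Prop. 1.2 (ii) pp. 10–11] [cite: DupuyHilado2025, §4.9, §4.12] -/
theorem norm_dEquiv_apply_le_of_factorwise_of_fixesBaseLine (hp2 : 2 < p)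
    (he : ∀ i, absRamificationIdx p (RescaledCompletion K p (w i) (hw i)) ≤ p - 2)
    (b : I) (hf : (w b).asIdeal.inertiaDeg ℤ = 1) (c : I → ℚ_[p]) (hcb : c b ≠ 0)
    (hfix : ∀ ψ ∈ ind1StripOf (w b) (galoisLog (w b)),
      RescaledCompletion.of K p (w b) (hw b) (ψ (p : (w b).adicCompletion K)) - (p : RescaledCompletion K p (w b) (hw b)) ∈
        (p : ℚ_[p]) • logUnits (RescaledCompletion K p (w b) (hw b)))
    (H : Subgroup (PacketAlgebra p (fun i => RescaledCompletion K p (w i) (hw i)) ≃ₗ[ℚ_[p]]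
      PacketAlgebra p (fun i => RescaledCompletion K p (w i) (hw i))))
    (hHfac : ∀ γ ∈ H, ∃ δ : Π i, AddAut ((w i).adicCompletion K),
      (∀ i, δ i ∈ AddSubgroup.closure (G := AddAut ((w i).adicCompletion K)) (ind1StripOf (w i) (galoisLog (w i)))) ∧
      ∀ z : Π i, RescaledCompletion K p (w i) (hw i),
        γ (PiTensorProduct.tprod ℚ_[p] z) =
          PiTensorProduct.tprod ℚ_[p] (fun i => RescaledCompletion.of K p (w i) (hw i)
            (δ i ((RescaledCompletion.of K p (w i) (hw i)).symm (z i)))))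
    {γ : PacketAlgebra p (fun i => RescaledCompletion K p (w i) (hw i)) ≃ₗ[ℚ_[p]]
      PacketAlgebra p (fun i => RescaledCompletion K p (w i) (hw i))} (hγ : γ ∈ H)
    (x : Π i, (w i).adicCompletion K)
    (hxb : ‖RescaledCompletion.of K p (w b) (hw b) (x b)‖ ≤ ‖c b‖ * (p : ℝ)⁻¹)
    (hx : ∀ i, i ≠ b → RescaledCompletion.of K p (w i) (hw i) (x i) ∈ c i • logUnits (RescaledCompletion K p (w i) (hw i)))
    (j : DIdx p (fun i => RescaledCompletion K p (w i) (hw i))) :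
    ‖dEquiv p (fun i => RescaledCompletion K p (w i) (hw i))
        (γ (PiTensorProduct.tprod ℚ_[p] (fun i => RescaledCompletion.of K p (w i) (hw i) (x i)))) j‖ ≤
      ‖c b‖ * (p : ℝ)⁻¹ *
        ∏ i ∈ Finset.univ.erase b, ‖c i‖ * (p : ℝ) ^ (-(1 / (absRamificationIdx p (RescaledCompletion K p (w i) (hw i)) : ℝ))) := by
  classical
  set k := fun i => RescaledCompletion K p (w i) (hw i) with hk
  set e := fun i => RescaledCompletion.of K p (w i) (hw i) with he_def
  obtain ⟨δ, hδ, hγz⟩ := hHfac γ hγ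
  -- the image is the pure tensor `⊗_i e_i(δ_i x_i)`
  have himg : γ (PiTensorProduct.tprod ℚ_[p] (fun i => e i (x i))) =
      PiTensorProduct.tprod ℚ_[p] (fun i => e i (δ i (x i))) := by
    rw [hγz]
    congr 1
  -- factor norms: the depth-`e_b` ball is carried onto itself at `b`; `c_i·log_p` is preserved elsewhere
  have hnb : ‖e b (δ b (x b))‖ ≤ ‖c b‖ * (p : ℝ)⁻¹ := by
    have hM := image_depthE_ball_eq_of_mem_closure_of_fixesBaseLine (w b) p (hw b) hp2 (he b) hf hcb hfix (hδ b)
    have hmem : (δ b) (x b) ∈ (δ b) '' {y | ‖e b y‖ ≤ ‖c b‖ * (p : ℝ)⁻¹} := ⟨x b, hxb, rfl⟩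
    rw [hM] at hmem
    exact hmem
  have hni : ∀ i, i ≠ b → ‖e i (δ i (x i))‖ ≤ ‖c i‖ * (p : ℝ) ^ (-(1 / (absRamificationIdx p (k i) : ℝ))) := by
    intro i hi
    obtain ⟨z, hz, hzx⟩ := Set.mem_smul_set.mp
      (of_apply_mem_smul_logUnits_of_mem_closure (w i) p (hw i) (hδ i) (c i) (hx i hi)).1
    rw [← hzx, norm_smul]
    exact mul_le_mul_of_nonneg_left (norm_le_rpow_of_norm_lt_one p (k i)
      ((mem_logUnits_iff_norm_lt_one_of_tame p hp2 (he i) z).mp hz)) (norm_nonneg _)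
  -- component norm of a pure tensor = product of the factor norms
  have hcomp : ‖dEquiv p k (PiTensorProduct.tprod ℚ_[p] (fun i => e i (δ i (x i)))) j‖ = ∏ i, ‖e i (δ i (x i))‖ := by
    have h := psi_purePacket_apply p k (DFac p k) (dEquiv p k) (fun i => e i (δ i (x i))) j
    simp only [purePacket] at h
    rw [h, norm_prod]
    exact Finset.prod_congr rfl fun i _ => norm_factorEmb p k (DFac p k) (dEquiv p k) i j _
  rw [himg, hcomp, ← Finset.mul_prod_erase Finset.univ (fun i => ‖e i (δ i (x i))‖) (Finset.mem_univ b)]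
  exact mul_le_mul hnb (Finset.prod_le_prod (fun i _ => norm_nonneg _) fun i hi => hni i (Finset.ne_of_mem_erase hi))
    (Finset.prod_nonneg fun i _ => norm_nonneg _) (by positivity)

/-- **THE BOX DEFECT OF A FAILING BIT (UNCONDITIONAL).**  Same setting.  The `(R_I)^∼`-hull of the orbit of the BOX under any factorwise-strip
`H` lies inside the polydisc of radius `R' = (‖c_b‖·p⁻¹)·Π_{i≠b} ‖c_i‖·p^{−1/e_i}` in EVERY Wedderburn component, whereas the container span
`(Π_i c_i)·log_p(R_I^×)` contains an element of component norms `R = Π_i ‖c_i‖·p^{−1/e_i}` (co-radial log-units, p527172) and `R' < R` as soon as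
`e_b ≥ 2` (`R' = R·p^{−(e_b−1)/e_b}`): at a factor with a failing bit the box is NOT inflated to the container's hull — for the box, the defect is
`e_b − 1` steps of `𝔪_{w_b}`, i.e. `(e_b−1)/e_b·log p` per unit weight (file 1's single-place defect, read on the packet).  The Θ-region
`ι_j(t)·(R_I)^∼ ⊇ ι_j(t)·R_I` is NOT covered when `(R_I)^∼ ≠ R_I`. [claim: Mochizuki2012, status: disputed]
[cite: Mochizuki2012, IUTchIII Rmk. 3.9.5 (i) p. 127; Cor. 3.12 Step (xi) p. 183; IUTchIV Prop. 1.4 (i) p. 13] [cite: DupuyHilado2025, §4.9, §4.12] -/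
theorem packetHull_orbit_box_subset_polydisc_of_fixesBaseLine [Nonempty I] (hp2 : 2 < p)
    (he : ∀ i, absRamificationIdx p (RescaledCompletion K p (w i) (hw i)) ≤ p - 2)
    (hd2 : ∀ i, 2 ≤ localDeg K (w i))
    (b : I) (hf : (w b).asIdeal.inertiaDeg ℤ = 1) (c : I → ℚ_[p]) (hc : ∀ i, c i ≠ 0)
    (hfix : ∀ ψ ∈ ind1StripOf (w b) (galoisLog (w b)),
      RescaledCompletion.of K p (w b) (hw b) (ψ (p : (w b).adicCompletion K)) - (p : RescaledCompletion K p (w b) (hw b)) ∈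
        (p : ℚ_[p]) • logUnits (RescaledCompletion K p (w b) (hw b)))
    (H : Subgroup (PacketAlgebra p (fun i => RescaledCompletion K p (w i) (hw i)) ≃ₗ[ℚ_[p]]
      PacketAlgebra p (fun i => RescaledCompletion K p (w i) (hw i))))
    (hHfac : ∀ γ ∈ H, ∃ δ : Π i, AddAut ((w i).adicCompletion K),
      (∀ i, δ i ∈ AddSubgroup.closure (G := AddAut ((w i).adicCompletion K)) (ind1StripOf (w i) (galoisLog (w i)))) ∧
      ∀ z : Π i, RescaledCompletion K p (w i) (hw i),
        γ (PiTensorProduct.tprod ℚ_[p] z) =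
          PiTensorProduct.tprod ℚ_[p] (fun i => RescaledCompletion.of K p (w i) (hw i)
            (δ i ((RescaledCompletion.of K p (w i) (hw i)).symm (z i))))) :
    (packetHull p (fun i => RescaledCompletion K p (w i) (hw i))
        (⋃ γ : H, (γ : PacketAlgebra p (fun i => RescaledCompletion K p (w i) (hw i)) ≃ₗ[ℚ_[p]]
            PacketAlgebra p (fun i => RescaledCompletion K p (w i) (hw i))) ''
          {y | ∃ x : Π i, (w i).adicCompletion K,
            ‖RescaledCompletion.of K p (w b) (hw b) (x b)‖ ≤ ‖c b‖ * (p : ℝ)⁻¹ ∧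
            (∀ i, i ≠ b → RescaledCompletion.of K p (w i) (hw i) (x i) ∈ c i • logUnits (RescaledCompletion K p (w i) (hw i))) ∧
            y = PiTensorProduct.tprod ℚ_[p] (fun i => RescaledCompletion.of K p (w i) (hw i) (x i))}) ⊆
      dEquiv p (fun i => RescaledCompletion K p (w i) (hw i)) ⁻¹'
        polydisc (DFac p (fun i => RescaledCompletion K p (w i) (hw i))) (fun _ =>
          ‖c b‖ * (p : ℝ)⁻¹ *
            ∏ i ∈ Finset.univ.erase b, ‖c i‖ * (p : ℝ) ^ (-(1 / (absRamificationIdx p (RescaledCompletion K p (w i) (hw i)) : ℝ))))) ∧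
    (2 ≤ absRamificationIdx p (RescaledCompletion K p (w b) (hw b)) →
      ‖c b‖ * (p : ℝ)⁻¹ *
          ∏ i ∈ Finset.univ.erase b, ‖c i‖ * (p : ℝ) ^ (-(1 / (absRamificationIdx p (RescaledCompletion K p (w i) (hw i)) : ℝ))) <
        ∏ i, ‖c i‖ * (p : ℝ) ^ (-(1 / (absRamificationIdx p (RescaledCompletion K p (w i) (hw i)) : ℝ)))) ∧
    (∃ y ∈ (∏ i, c i) • (logPacket p (fun i => RescaledCompletion K p (w i) (hw i)) :
        Set (PacketAlgebra p (fun i => RescaledCompletion K p (w i) (hw i)))),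
      ∀ j, ‖dEquiv p (fun i => RescaledCompletion K p (w i) (hw i)) y j‖ =
        ∏ i, ‖c i‖ * (p : ℝ) ^ (-(1 / (absRamificationIdx p (RescaledCompletion K p (w i) (hw i)) : ℝ)))) := by
  classical
  set k := fun i => RescaledCompletion K p (w i) (hw i) with hk
  set e := fun i => RescaledCompletion.of K p (w i) (hw i) with he_def
  set R' : ℝ := ‖c b‖ * (p : ℝ)⁻¹ *
    ∏ i ∈ Finset.univ.erase b, ‖c i‖ * (p : ℝ) ^ (-(1 / (absRamificationIdx p (k i) : ℝ))) with hR'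
  have hP : p.Prime := Fact.out
  have hp1 : (1 : ℝ) < p := by exact_mod_cast hP.one_lt
  have hp0 : (0 : ℝ) < p := by positivity
  have hR'0 : 0 ≤ R' := by positivity
  refine ⟨?_, fun hE2 => ?_, ?_⟩
  · -- every element of the orbit has components `≤ R'`, hence so does its hull
    set O := ⋃ γ : H, (γ : PacketAlgebra p k ≃ₗ[ℚ_[p]] PacketAlgebra p k) ''
        {y | ∃ x : Π i, (w i).adicCompletion K, ‖e b (x b)‖ ≤ ‖c b‖ * (p : ℝ)⁻¹ ∧
          (∀ i, i ≠ b → e i (x i) ∈ c i • logUnits (k i)) ∧ y = PiTensorProduct.tprod ℚ_[p] (fun i => e i (x i))} with hO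
    have hOle : ∀ y ∈ O, ∀ j, ‖dEquiv p k y j‖ ≤ R' := by
      intro y hy j
      obtain ⟨γ, _, ⟨x, hxb, hx, rfl⟩, rfl⟩ := Set.mem_iUnion.mp hy
      exact norm_dEquiv_apply_le_of_factorwise_of_fixesBaseLine p w hw hp2 he b hf c (hc b) hfix H hHfac γ.2 x hxb hx j
    have hObdd : IsBounded (dEquiv p k '' O) := by
      refine (isBounded_polydisc (DFac p k) (fun _ => R')).subset ?_
      rintro _ ⟨y, hy, rfl⟩
      exact (mem_polydisc (DFac p k)).mpr (hOle y hy)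
    have hrad : ∀ j, hullRadius (DFac p k) (dEquiv p k '' O) j ≤ R' := fun j =>
      hullRadius_le_of_nonneg (DFac p k) hR'0 (by rintro _ ⟨y, hy, rfl⟩; exact hOle y hy j)
    intro y hy
    rw [packetHull_eq_preimage_holomorphicHull p k (DFac p k) (dEquiv p k) hObdd, Set.mem_preimage,
      holomorphicHull_of_isBounded (DFac p k) hObdd, mem_polydisc] at hy
    exact (mem_polydisc (DFac p k)).mpr fun j => (hy j).trans (hrad j)
  · -- `R' < R`: the factor at `b` is `‖c_b‖·p⁻¹ < ‖c_b‖·p^{−1/e_b}`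
    rw [← Finset.mul_prod_erase Finset.univ (fun i => ‖c i‖ * (p : ℝ) ^ (-(1 / (absRamificationIdx p (k i) : ℝ))))
      (Finset.mem_univ b)]
    refine mul_lt_mul_of_pos_right ((coe_span_depthE_ball_eq_closedBall (w b) p (hw b) (c b)).2 hE2 (hc b)) ?_
    exact Finset.prod_pos fun i _ => mul_pos (norm_pos_iff.mpr (hc i)) (Real.rpow_pos_of_pos hp0 _)
  · -- the container span attains `R`: the pure tensor of `c_i·(co-radial log-unit)`
    have hd2' : ∀ i, 2 ≤ Module.finrank ℚ_[p] (k i) := fun i => by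
      change 2 ≤ Module.finrank ℚ_[p] (RescaledCompletion K p (w i) (hw i))
      rw [finrank_rescaledCompletion_eq_localDeg]; exact hd2 i
    have hmaxes : ∀ i, ∃ z ∈ logUnits (k i), ‖z‖ = (p : ℝ) ^ (-(1 / (absRamificationIdx p (k i) : ℝ))) := by
      intro i
      obtain ⟨z, hz, -, hzn, -⟩ :=
        TraceZeroCoradial.exists_mem_logUnits_trace_eq_zero_isMaxOn_of_tame p (k i) hp2 (he i) (hd2' i)
      exact ⟨z, hz, hzn⟩
    choose zm hzm hzmn using hmaxes
    refine ⟨(∏ i, c i) • purePacket p k zm, Set.smul_mem_smul_set (purePacket_mem_logPacket_of_mem p k hzm), fun j => ?_⟩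
    rw [map_smul, Pi.smul_apply, norm_smul, psi_purePacket_apply p k (DFac p k) (dEquiv p k) zm j, norm_prod, norm_prod,
      ← Finset.prod_mul_distrib]
    exact Finset.prod_congr rfl fun i _ => by rw [norm_factorEmb, hzmn]

end Packet

end Summit.ABC.IUTFork.Thm311.Real

end
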